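import Mathlib
import Summits.ResolutionOfSingularities.ResolutionOfSingularities.Theorems.WeightedInvariantLocalWeightedDropNCResSettingHeadDrop
import Summits.ResolutionOfSingularities.ResolutionOfSingularities.Theorems.WeightedInvariantLocalWeightedDropTOT2E1Step
import Summits.ResolutionOfSingularities.ResolutionOfSingularities.Theorems.WeightedInvariantLocalWeightedDropAxisMove

/-!
# `WeightedInvariant.LocalWeightedDrop`: NC-RESOLUTION SETTINGS for the TOT₂ line (S-SET), part 13 — THE HEAD-DROP ADAPTER AFTER A
# COORDINATE CHANGE: directrix transport under legal `Φ`, B-permissibility from the I₃-device in the move's coordinates, and the sub-regime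
# «`e(g) = 1`, the point lies ON a permissible curve that is an axis of letter-preserving coordinates» (¬HISOL with a letter-preserving `Φ`)

Crux item stmt-ResolutionOfSingularities-8899 `LocalWeightedDrop` (route `ResolutionOfSingularities/WeightedInvariant`), ENGINE skeleton v32,
residual `stub_spaceNCRankDrop`; TOT2-LINE v1.1/v1.2 (res-L1-w43-lead-1).  [OURS · L1 W4.3 · chain w43 · seat res-L1-w43-stub-1 gen 6 (S-SET
author); def-free; consumes res-L1-w43-stub-3's (N3) `TOT2Near.order_slice_lt_of_apexLine_curve` and res-type-056's `TOT2E1.initEval_subst_legal`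
without restating them; the count game is the programme's own; nothing here is a statement of any manuscript; AI-produced, gate-checked, weaker
than expert review.]

WHY.  res-type-056's decorated S-E1 (`TOT2E1.dWinsTo_headDrop_of_isolated`, p536552) treats the states with apex dimension `e(g) = 1` that are
ISOLATED (HISOL: in NO legal coordinates is the last axis permissible for `g = f·∏_O x_l`, i.e. `¬ InAxisIdeal c (Φ^* g)` for every legal `Φ`);
res-L1-w43-lead-1's label regime S-E2′ treats `e(g) = 2`; E0 treats `e(g) = 0` (part 12).  The states with `e(g) = 1` lying ON a permissible smooth
curve are nobody's unless the curve is blown up: the point move keeps them near forever (cylinder over a node).  When the curve is the axis of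
LETTER-PRESERVING legal coordinates `Φ` (every boundary letter goes to a unit times a letter — automatic at the start of a phase, where all letters are
old and the curve lies inside every old component), the curve move `(Φ, 𝟙_{x})` is B-permissible and — the directrix being the curve's tangent line —
has NO near point: the head drops at every answer.  (The residual «no letter-preserving `Φ`» = a conflict with NEW letter planes is a finite loop of
point moves; not in this file.)

* `inv_subst_legal`, **`apexLine_subst_legal`**, `apexTrivial_subst_legal` — DIRECTRIX TRANSPORT: the invariance vectors of `in_c(Φ^* g)` are the
  `M⁻¹`-images of those of `in_c g` (`M` = linear part of `Φ`), so «every two invariance vectors dependent» / «only the zero vector» pass to `Φ^* g`.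
* **`isBPermissible_of_totalO_weightedOrder`** — B-PERMISSIBILITY FROM THE I₃-DEVICE IN THE MOVE'S COORDINATES: a legal letter-preserving `(Φ, w)`
  with `c ≤ weightedOrder_w (Φ^* g)` is B-permissible (`isBPermissible_iff_totalO` + order invariance).
* **`dWinsTo_headDrop_of_apexLine_curve`** — from an admissibly decorated position, a B-permissible move with a weight-`0` slot (centre of positive
  dimension) at apex dimension `≤ 1` of `in_c g` wins the head phase IN ONE MOVE ((N3) on `Φ^* g` + part 12's `dWinsTo_headDrop_of_orderDrop`).
* `weight_indicator_castSucc_eq_xDeg`, `le_weightedOrder_of_inAxisIdeal`, **`dWinsTo_headDrop_of_inAxisIdeal`** — THE ¬HISOL CASE WITH A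
  LETTER-PRESERVING WITNESS: `InAxisIdeal c (Φ^* g)` for a legal letter-preserving `Φ`, and `e(g) ≤ 1` ⇒ head drop in one move (the axis move
  `(Φ, 𝟙_{first m letters})`).
-/

set_option linter.dupNamespace false -- mandated namespace of this single-conjunct summit

noncomputable section

namespace Summit.ResolutionOfSingularities.ResolutionOfSingularities.Theorems

namespace TameFourTupleDrop

open MvPowerSeries Literature.AlgebraicGeometry.Resolution AxisPolyhedron

variable {k : Type} [Field k] {m : ℕ}

/-! ## Directrix transport under a legal coordinate change -/

/-- **INVARIANCE VECTORS UNDER A LEGAL COORDINATE CHANGE.**  If `u` is an invariance vector of the degree-`d` form of `Φ^* g` (`ord g = d`), then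
`M u` is an invariance vector of the degree-`d` form of `g`, `M` the linear part of `Φ` (res-type-056's `TOT2E1.initEval_subst_legal`:
`in_d(Φ^* g)(v) = in_d(g)(M v)`). -/
theorem inv_subst_legal {n : ℕ} (Φ : Fin (n + 1) → MvPowerSeries (Fin (n + 1)) k) (hΦ0 : ∀ i, constantCoeff (Φ i) = 0)
    (hΦdet : IsUnit (Matrix.det (Matrix.of fun i j : Fin (n + 1) => coeff (Finsupp.single j 1) (Φ i))))
    (g : MvPowerSeries (Fin (n + 1)) k) {d : ℕ} (hgd : g.order = d) {u : Fin (n + 1) → k}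
    (hu : ∀ v, CobordantChart.initEval (fun _ : Fin (n + 1) => 1) (v + u) d (subst Φ g) =
      CobordantChart.initEval (fun _ : Fin (n + 1) => 1) v d (subst Φ g)) (v : Fin (n + 1) → k) :
    CobordantChart.initEval (fun _ : Fin (n + 1) => 1)
        (v + (Matrix.of fun i j : Fin (n + 1) => coeff (Finsupp.single j 1) (Φ i)).mulVec u) d g =
      CobordantChart.initEval (fun _ : Fin (n + 1) => 1) v d g := by
  set M : Matrix (Fin (n + 1)) (Fin (n + 1)) k := Matrix.of fun i j : Fin (n + 1) => coeff (Finsupp.single j 1) (Φ i) with hM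
  have hsurj : Function.Surjective M.mulVec :=
    Matrix.mulVec_surjective_iff_isUnit.mpr ((Matrix.isUnit_iff_isUnit_det M).mpr hΦdet)
  obtain ⟨v', rfl⟩ := hsurj v
  have h := hu v'
  rw [TOT2E1.initEval_subst_legal Φ hΦ0 hΦdet g hgd, TOT2E1.initEval_subst_legal Φ hΦ0 hΦdet g hgd, Matrix.mulVec_add] at h
  exact h

/-- **APEX DIMENSION ≤ 1 PASSES TO THE MOVE'S COORDINATES**: if every two invariance vectors of `in_d g` are dependent, so are every two
invariance vectors of `in_d (Φ^* g)` for a legal `Φ`. -/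
theorem apexLine_subst_legal {n : ℕ} (Φ : Fin (n + 1) → MvPowerSeries (Fin (n + 1)) k) (hΦ0 : ∀ i, constantCoeff (Φ i) = 0)
    (hΦdet : IsUnit (Matrix.det (Matrix.of fun i j : Fin (n + 1) => coeff (Finsupp.single j 1) (Φ i))))
    (g : MvPowerSeries (Fin (n + 1)) k) {d : ℕ} (hgd : g.order = d)
    (hone : ∀ u₁ u₂ : Fin (n + 1) → k,
      (∀ v, CobordantChart.initEval (fun _ : Fin (n + 1) => 1) (v + u₁) d g = CobordantChart.initEval (fun _ : Fin (n + 1) => 1) v d g) →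
      (∀ v, CobordantChart.initEval (fun _ : Fin (n + 1) => 1) (v + u₂) d g = CobordantChart.initEval (fun _ : Fin (n + 1) => 1) v d g) →
      ∃ α β : k, (α ≠ 0 ∨ β ≠ 0) ∧ α • u₁ + β • u₂ = 0)
    (u₁ u₂ : Fin (n + 1) → k)
    (hu₁ : ∀ v, CobordantChart.initEval (fun _ : Fin (n + 1) => 1) (v + u₁) d (subst Φ g) =
      CobordantChart.initEval (fun _ : Fin (n + 1) => 1) v d (subst Φ g))
    (hu₂ : ∀ v, CobordantChart.initEval (fun _ : Fin (n + 1) => 1) (v + u₂) d (subst Φ g) =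
      CobordantChart.initEval (fun _ : Fin (n + 1) => 1) v d (subst Φ g)) :
    ∃ α β : k, (α ≠ 0 ∨ β ≠ 0) ∧ α • u₁ + β • u₂ = 0 := by
  set M : Matrix (Fin (n + 1)) (Fin (n + 1)) k := Matrix.of fun i j : Fin (n + 1) => coeff (Finsupp.single j 1) (Φ i) with hM
  have hinj : Function.Injective M.mulVec :=
    Matrix.mulVec_injective_iff_isUnit.mpr ((Matrix.isUnit_iff_isUnit_det M).mpr hΦdet)
  obtain ⟨α, β, hαβ, hlin⟩ := hone (M.mulVec u₁) (M.mulVec u₂) (inv_subst_legal Φ hΦ0 hΦdet g hgd hu₁)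
    (inv_subst_legal Φ hΦ0 hΦdet g hgd hu₂)
  refine ⟨α, β, hαβ, hinj ?_⟩
  rw [Matrix.mulVec_add, Matrix.mulVec_smul, Matrix.mulVec_smul, hlin, Matrix.mulVec_zero]

/-- **TRIVIAL APEX PASSES TO THE MOVE'S COORDINATES.** -/
theorem apexTrivial_subst_legal {n : ℕ} (Φ : Fin (n + 1) → MvPowerSeries (Fin (n + 1)) k) (hΦ0 : ∀ i, constantCoeff (Φ i) = 0)
    (hΦdet : IsUnit (Matrix.det (Matrix.of fun i j : Fin (n + 1) => coeff (Finsupp.single j 1) (Φ i))))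
    (g : MvPowerSeries (Fin (n + 1)) k) {d : ℕ} (hgd : g.order = d)
    (hapex : ∀ u : Fin (n + 1) → k,
      (∀ v, CobordantChart.initEval (fun _ : Fin (n + 1) => 1) (v + u) d g = CobordantChart.initEval (fun _ : Fin (n + 1) => 1) v d g) →
      u = 0)
    (u : Fin (n + 1) → k)
    (hu : ∀ v, CobordantChart.initEval (fun _ : Fin (n + 1) => 1) (v + u) d (subst Φ g) =
      CobordantChart.initEval (fun _ : Fin (n + 1) => 1) v d (subst Φ g)) : u = 0 := by
  set M : Matrix (Fin (n + 1)) (Fin (n + 1)) k := Matrix.of fun i j : Fin (n + 1) => coeff (Finsupp.single j 1) (Φ i) with hM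
  have hinj : Function.Injective M.mulVec :=
    Matrix.mulVec_injective_iff_isUnit.mpr ((Matrix.isUnit_iff_isUnit_det M).mpr hΦdet)
  have h := hapex (M.mulVec u) (inv_subst_legal Φ hΦ0 hΦdet g hgd hu)
  exact hinj (by rw [h, Matrix.mulVec_zero])

/-! ## B-permissibility from the I₃-device in the move's coordinates -/

/-- The order of `g = f·∏_O x_l` in any legal coordinates is the head letter `c`. -/
theorem Decoration.order_subst_totalO {b : MvPowerSeries (Fin (m + 1)) k} {δ : Decoration k m} (hadm : Admissible b δ)
    {Φ : Fin (m + 1) → MvPowerSeries (Fin (m + 1)) k} {w : Fin (m + 1) → ℕ} (hmv : IsCountMove Φ w) :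
    (subst Φ (δ.f * ∏ l ∈ δ.O, X l)).order = (δ.c : ℕ∞) := by
  rw [NCTransport.order_subst_eq_of_isUnit_det hmv.1 hmv.2.1, Decoration.order_totalO hadm]

/-- **B-PERMISSIBILITY FROM THE I₃-DEVICE IN THE MOVE'S COORDINATES**: a legal move `(Φ, w)` that straightens the boundary letters and has
`c ≤ weightedOrder_w (Φ^* g)` (its centre is permissible for `g = f·∏_O x_l`) is B-permissible. -/
theorem isBPermissible_of_totalO_weightedOrder {b : MvPowerSeries (Fin (m + 1)) k} {δ : Decoration k m} (hadm : Admissible b δ)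
    {Φ : Fin (m + 1) → MvPowerSeries (Fin (m + 1)) k} {w : Fin (m + 1) → ℕ} (hmv : IsCountMove Φ w)
    (hP3 : ∀ l ∈ δ.E, ∃ (l' : Fin (m + 1)) (u : MvPowerSeries (Fin (m + 1)) k), constantCoeff u ≠ 0 ∧ Φ l = u * X l')
    (hP1g : (δ.c : ℕ∞) ≤ (subst Φ (δ.f * ∏ l ∈ δ.O, X l)).weightedOrder w) : IsBPermissible δ Φ w := by
  refine (isBPermissible_iff_totalO hmv hadm.2.1.ne_zero hP3).mpr ?_
  rw [Decoration.order_subst_totalO hadm hmv]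
  exact hP1g

/-! ## The permissible curve at apex dimension ≤ 1, in the move's coordinates -/

/-- **A B-PERMISSIBLE CENTRE OF POSITIVE DIMENSION AT APEX DIMENSION ≤ 1 WINS THE HEAD PHASE IN ONE MOVE** (OURS · L1 W4.3): from an
admissibly decorated position, a B-permissible move `(Φ, w)` with a weight-`0` slot, when every two invariance vectors of `in_c g` are dependent
(`g = f·∏_O x_l`, `e(g) ≤ 1`, hypothesis in the position's OWN coordinates), forces «admissibly decorated of smaller head» in one move:
by directrix transport and res-L1-w43-stub-3's (N3) every answer is non-near. -/
theorem dWinsTo_headDrop_of_apexLine_curve {b : MvPowerSeries (Fin (m + 1)) k} {δ : Decoration k m} (hadm : Admissible b δ)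
    {Φ : Fin (m + 1) → MvPowerSeries (Fin (m + 1)) k} {w : Fin (m + 1) → ℕ} (hperm : IsBPermissible δ Φ w)
    {l₀ : Fin (m + 1)} (hl₀ : w l₀ = 0)
    (hone : ∀ u₁ u₂ : Fin (m + 1) → k,
      (∀ v, CobordantChart.initEval (fun _ : Fin (m + 1) => 1) (v + u₁) δ.c (δ.f * ∏ l ∈ δ.O, X l) =
        CobordantChart.initEval (fun _ : Fin (m + 1) => 1) v δ.c (δ.f * ∏ l ∈ δ.O, X l)) →
      (∀ v, CobordantChart.initEval (fun _ : Fin (m + 1) => 1) (v + u₂) δ.c (δ.f * ∏ l ∈ δ.O, X l) =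
        CobordantChart.initEval (fun _ : Fin (m + 1) => 1) v δ.c (δ.f * ∏ l ∈ δ.O, X l)) →
      ∃ α β : k, (α ≠ 0 ∨ β ≠ 0) ∧ α • u₁ + β • u₂ = 0) :
    DWinsTo (St := MvPowerSeries (Fin (m + 1)) k × Decoration k m) Prod.fst
      (fun τ => Admissible τ.1 τ.2 ∧ τ.2.head < δ.head) (b, δ) := by
  have hmv : IsCountMove Φ w := hperm.1
  have hP3 := hperm.2.2.2
  have hordΦ : (subst Φ (δ.f * ∏ l ∈ δ.O, X l)).order = (δ.c : ℕ∞) := Decoration.order_subst_totalO hadm hmv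
  have hP1g : (δ.c : ℕ∞) ≤ (subst Φ (δ.f * ∏ l ∈ δ.O, X l)).weightedOrder w := by
    rw [← hordΦ]
    exact (isBPermissible_iff_totalO hmv hadm.2.1.ne_zero hP3).mp hperm
  refine dWinsTo_headDrop_of_orderDrop hadm hperm fun c hc hc0 A G hfac hG i hci => ?_
  obtain ⟨hA, -⟩ := Decoration.order_slice_totalO_eq hperm hc hadm.2.1.ne_zero hci hfac hG
  subst hA
  exact TOT2Near.order_slice_lt_of_apexLine_curve w c hmv.2.2.1 hc i hci _ hP1g
    (apexLine_subst_legal Φ hmv.1 hmv.2.1 _ (Decoration.order_totalO hadm) hone) hl₀ hfac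

/-! ## The ¬HISOL case with a letter-preserving witness -/

/-- The weight of an exponent for the weights `𝟙_{first m letters}` (`1` on the `castSucc` slots, `0` on the last) is its `xDeg`. -/
theorem weight_indicator_castSucc_eq_xDeg (E : Fin (m + 1) →₀ ℕ) :
    Finsupp.weight (fun j : Fin (m + 1) => if j = Fin.last m then 0 else 1) E = xDeg E :=
  AxisMove.weight_eq_xDeg (w := fun j : Fin (m + 1) => if j = Fin.last m then 0 else 1) (if_pos rfl)
    (fun j => if_neg (Fin.castSucc_lt_last j).ne) E

/-- `InAxisIdeal c G` (every monomial of `G` has `x`-degree `≥ c`: the last axis is permissible) ⇒ `c ≤ weightedOrder_{𝟙_{first m letters}} G`. -/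
theorem le_weightedOrder_of_inAxisIdeal {G : MvPowerSeries (Fin (m + 1)) k} {c : ℕ} (hin : InAxisIdeal c G) :
    (c : ℕ∞) ≤ G.weightedOrder (fun j : Fin (m + 1) => if j = Fin.last m then 0 else 1) := by
  refine le_weightedOrder _ fun E hE => ?_
  by_contra hne
  rw [weight_indicator_castSucc_eq_xDeg, Nat.cast_lt] at hE
  exact hne (hin E hE)

/-- **THE ¬HISOL CASE WITH A LETTER-PRESERVING WITNESS WINS THE HEAD PHASE IN ONE MOVE** (OURS · L1 W4.3; the complement of res-type-056's
S-E1 hypothesis HISOL inside apex dimension `≤ 1`, when the witness `Φ` straightens the boundary letters — e.g. at the start of a phase): if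
`InAxisIdeal c (Φ^* g)` for a legal letter-preserving `Φ` (the image of the last axis is a permissible curve for `g = f·∏_O x_l`) and every two
invariance vectors of `in_c g` are dependent, then the axis move `(Φ, 𝟙_{first m letters})` is B-permissible and the head drops at every answer
(`m ≥ 1`: the centre is a curve or bigger, the point move is excluded by `IsCountMove`'s «some positive weight», which needs a `castSucc` slot). -/
theorem dWinsTo_headDrop_of_inAxisIdeal {b : MvPowerSeries (Fin (m + 1)) k} {δ : Decoration k m} (hadm : Admissible b δ) (hm : 0 < m)
    {Φ : Fin (m + 1) → MvPowerSeries (Fin (m + 1)) k} (hΦ0 : ∀ i, constantCoeff (Φ i) = 0)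
    (hΦdet : IsUnit (Matrix.det (Matrix.of fun i j : Fin (m + 1) => coeff (Finsupp.single j 1) (Φ i))))
    (hP3 : ∀ l ∈ δ.E, ∃ (l' : Fin (m + 1)) (u : MvPowerSeries (Fin (m + 1)) k), constantCoeff u ≠ 0 ∧ Φ l = u * X l')
    (hin : InAxisIdeal δ.c (subst Φ (δ.f * ∏ l ∈ δ.O, X l)))
    (hone : ∀ u₁ u₂ : Fin (m + 1) → k,
      (∀ v, CobordantChart.initEval (fun _ : Fin (m + 1) => 1) (v + u₁) δ.c (δ.f * ∏ l ∈ δ.O, X l) =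
        CobordantChart.initEval (fun _ : Fin (m + 1) => 1) v δ.c (δ.f * ∏ l ∈ δ.O, X l)) →
      (∀ v, CobordantChart.initEval (fun _ : Fin (m + 1) => 1) (v + u₂) δ.c (δ.f * ∏ l ∈ δ.O, X l) =
        CobordantChart.initEval (fun _ : Fin (m + 1) => 1) v δ.c (δ.f * ∏ l ∈ δ.O, X l)) →
      ∃ α β : k, (α ≠ 0 ∨ β ≠ 0) ∧ α • u₁ + β • u₂ = 0) :
    DWinsTo (St := MvPowerSeries (Fin (m + 1)) k × Decoration k m) Prod.fst
      (fun τ => Admissible τ.1 τ.2 ∧ τ.2.head < δ.head) (b, δ) := by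
  have hmv : IsCountMove Φ (fun j : Fin (m + 1) => if j = Fin.last m then 0 else 1) := by
    refine ⟨hΦ0, hΦdet, fun j => ?_, ⟨Fin.castSucc ⟨0, hm⟩, ?_⟩⟩
    · show (if j = Fin.last m then (0 : ℕ) else 1) ≤ 1
      split_ifs <;> simp
    · show 0 < (if Fin.castSucc (⟨0, hm⟩ : Fin m) = Fin.last m then (0 : ℕ) else 1)
      rw [if_neg (Fin.castSucc_lt_last _).ne]
      exact Nat.one_pos
  have hperm : IsBPermissible δ Φ (fun j : Fin (m + 1) => if j = Fin.last m then 0 else 1) :=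
    isBPermissible_of_totalO_weightedOrder hadm hmv hP3 (le_weightedOrder_of_inAxisIdeal hin)
  exact dWinsTo_headDrop_of_apexLine_curve hadm hperm (l₀ := Fin.last m) (if_pos rfl) hone

end TameFourTupleDrop

end Summit.ResolutionOfSingularities.ResolutionOfSingularities.Theorems

end
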